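import Mathlib.Analysis.SpecialFunctions.Gamma.BohrMollerup
import Mathlib.Analysis.SpecialFunctions.Stirling
import HarnessLib

/-!
# A Stirling-type lower bound for `log Γ` on the positive reals

Topic `Literature/Analysis/SpecialFunctions`. Everything in this file is PROVED (no named facts).

Main result (`Literature.Analysis.SpecialFunctions.LogGammaStirling.log_gamma_ge_stirling`): for every real `y > 0`,
`log Γ(y) ≥ (y - ½) log y - y + ½ log(2π) + 1/(12y + 6)`,
and its exponentiated form `gamma_ge_stirling`. Mathlib has Stirling's formula and the effective
lower bound `Stirling.le_log_factorial_stirling` for `n!` (natural `n`) and the Bohr–Mollerup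
convexity bounds for `Γ(n + x)`, but no Stirling-type bound for `Γ` at real arguments; this file
supplies the lower bound needed to certify numerical values of `Γ(1 + x)` at rational `x`
(used for Rankin's constant in `Literature/Barriers/ABC`).

## Proof (Binet's remainder, telescoped)

With `μ(y) = log Γ(y) - ((y - ½) log y - y + ½ log 2π)` (not introduced as a definition):
* `binet_step`: `μ(y) - μ(y+1) = (y + ½) log(1 + 1/y) - 1` (functional equation of `Γ`);
* `binet_term_ge`: this is `≥ 1/(3(2y+1)²)`, keeping two terms of Mathlib's series
  `Real.hasSum_log_one_add_inv` for `log(1 + 1/y)` in powers of `1/(2y+1)`;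
* `binet_ge_neg`: `μ(y) ≥ -3/(y-2)` for `y > 2`, from `Real.BohrMollerup.f_add_nat_ge`
  (`log Γ(n+x) ≥ log (n-1)! + x log(n-1)`) and `Stirling.le_log_factorial_stirling`;
* telescoping `μ(y) = ∑_{k<K} (μ(y+k) - μ(y+k+1)) + μ(y+K)`, the bound
  `∑_{k<K} 1/(3(2(y+k)+1)²) ≥ (1/12)(1/(y+½) - 1/(y+K+½))` and `K → ∞`.

The classical sharper statements (`1/(12y+1) < μ(y) < 1/(12y)`, Robbins 1955, for integers;
Binet's series in general) are textbook material, e.g. Whittaker–Watson, *A Course of Modern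
Analysis*, §12.33; the weaker constant `6` in `1/(12y+6)` is what the two-term truncation gives
and suffices for certified numerics after shifting the argument. [folklore]
-/

noncomputable section

open Real Filter Topology Finset

namespace Literature.Analysis.SpecialFunctions.LogGammaStirling

/-- The Binet remainder `μ(y) = log Γ(y) - ((y - ½) log y - y + ½ log(2π))`. We do not introduce a
definition; this lemma is the functional equation `μ(y) - μ(y+1) = (y + ½) log(1 + 1/y) - 1`.
[folklore] -/
theorem binet_step {y : ℝ} (hy : 0 < y) :
    (Real.log (Real.Gamma y) - ((y - 1 / 2) * Real.log y - y + Real.log (2 * π) / 2))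
      - (Real.log (Real.Gamma (y + 1)) -
          ((y + 1 - 1 / 2) * Real.log (y + 1) - (y + 1) + Real.log (2 * π) / 2))
      = (y + 1 / 2) * Real.log (1 + y⁻¹) - 1 := by
  rw [Real.Gamma_add_one hy.ne', Real.log_mul hy.ne' (Real.Gamma_pos_of_pos hy).ne']
  have : Real.log (1 + y⁻¹) = Real.log (y + 1) - Real.log y := by
    rw [← Real.log_div (by positivity) hy.ne']
    congr 1; field_simp
  rw [this]; ring

/-- The Binet summand is at least `1/(3(2y+1)²)`: from the series
`log(1 + 1/y) = ∑_k 2/(2k+1) · (2y+1)^{-(2k+1)}` (Mathlib's `Real.hasSum_log_one_add_inv`),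
keeping two terms. [folklore] -/
theorem binet_term_ge {y : ℝ} (hy : 0 < y) :
    1 / (3 * (2 * y + 1) ^ 2) ≤ (y + 1 / 2) * Real.log (1 + y⁻¹) - 1 := by
  have hs := Real.hasSum_log_one_add_inv hy
  have h2 := sum_le_hasSum (Finset.range 2) (fun k _ => by positivity) hs
  simp only [Finset.sum_range_succ, Finset.sum_range_zero, zero_add] at h2
  have hu : 0 < 2 * y + 1 := by linarith
  have e : (2 : ℝ) * (1 / (2 * (0 : ℕ) + 1)) * (1 / (2 * y + 1)) ^ (2 * (0 : ℕ) + 1)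
      + 2 * (1 / (2 * (1 : ℕ) + 1)) * (1 / (2 * y + 1)) ^ (2 * (1 : ℕ) + 1)
      = 2 / (2 * y + 1) + 2 / (3 * (2 * y + 1) ^ 3) := by
    have h3 : (2 : ℝ) * y + 1 ≠ 0 := hu.ne'
    norm_num
    field_simp
  rw [e] at h2
  have hyp : 0 < y + 1 / 2 := by linarith
  have e2 : (y + 1 / 2) * (2 / (2 * y + 1) + 2 / (3 * (2 * y + 1) ^ 3)) =
      1 + 1 / (3 * (2 * y + 1) ^ 2) := by
    field_simp
  nlinarith [mul_le_mul_of_nonneg_left h2 hyp.le]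

/-- Telescoping the functional equation: `μ(y) = ∑_{k<K} (μ(y+k) - μ(y+k+1)) + μ(y+K)`, written as
a lower bound with `binet_term_ge`. [folklore] -/
theorem binet_ge_sum (y : ℝ) (hy : 0 < y) (K : ℕ) :
    (∑ k ∈ range K, 1 / (3 * (2 * (y + k) + 1) ^ 2))
      + (Real.log (Real.Gamma (y + K)) -
          ((y + K - 1 / 2) * Real.log (y + K) - (y + K) + Real.log (2 * π) / 2))
      ≤ Real.log (Real.Gamma y) - ((y - 1 / 2) * Real.log y - y + Real.log (2 * π) / 2) := by
  induction K with
  | zero => simp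
  | succ K ih =>
    have hyK : 0 < y + K := by positivity
    have hstep := binet_step hyK
    have hterm := binet_term_ge hyK
    rw [Finset.sum_range_succ]
    push_cast
    have e : y + (K + 1) = y + K + 1 := by ring
    rw [e]
    linarith

/-- The telescoping sum dominates `(1/12)(1/(y+½) - 1/(y+K+½))`. [folklore] -/
theorem sum_binet_term_ge (y : ℝ) (hy : 0 < y) (K : ℕ) :
    (1 / 12) * (1 / (y + 1 / 2) - 1 / (y + K + 1 / 2))
      ≤ ∑ k ∈ range K, 1 / (3 * (2 * (y + k) + 1) ^ 2) := by
  induction K with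
  | zero => simp
  | succ K ih =>
    rw [Finset.sum_range_succ]
    push_cast
    have hyK : 0 < y + K := by positivity
    have h1 : (1 / 12) * (1 / (y + K + 1 / 2) - 1 / (y + K + 1 + 1 / 2))
        ≤ 1 / (3 * (2 * (y + K) + 1) ^ 2) := by
      have ha : 0 < y + K + 1 / 2 := by positivity
      have e1 : (1 / 12) * (1 / (y + K + 1 / 2) - 1 / (y + K + 1 + 1 / 2))
          = 1 / (12 * ((y + K + 1 / 2) * (y + K + 1 + 1 / 2))) := by
        field_simp
        ring
      have e2 : (3 : ℝ) * (2 * (y + K) + 1) ^ 2 = 12 * ((y + K + 1 / 2) * (y + K + 1 / 2)) := by ring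
      rw [e1, e2]
      apply one_div_le_one_div_of_le (by positivity)
      nlinarith
    have e : y + (K + 1 : ℝ) + 1 / 2 = y + K + 1 + 1 / 2 := by ring
    rw [e]
    linarith

/-- The Binet remainder is `≥ -3/(y-2)` for `y > 2`: Bohr–Mollerup's convexity bound
`log Γ(n+x) ≥ log Γ(n) + x log(n-1)` (`Real.BohrMollerup.f_add_nat_ge`) combined with the
effective Stirling lower bound for `log (n-1)!` (`Stirling.le_log_factorial_stirling`).
[folklore] -/
theorem binet_ge_neg {y : ℝ} (hy : 2 < y) :
    -3 / (y - 2) ≤ Real.log (Real.Gamma y) - ((y - 1 / 2) * Real.log y - y + Real.log (2 * π) / 2) := by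
  -- write `y = n + x`, `n = ⌈y⌉ - 1 ≥ 2`, `0 < x ≤ 1`
  set n : ℕ := ⌈y⌉₊ - 1 with hn
  have hceil : (⌈y⌉₊ : ℝ) < y + 1 := Nat.ceil_lt_add_one (by linarith)
  have hceil' : y ≤ (⌈y⌉₊ : ℝ) := Nat.le_ceil y
  have h3 : 3 ≤ ⌈y⌉₊ := by
    have : (2 : ℝ) < ⌈y⌉₊ := lt_of_lt_of_le hy hceil'
    have : (2 : ℕ) < ⌈y⌉₊ := by exact_mod_cast this
    omega
  have hn2 : 2 ≤ n := by omega
  have hncast : (n : ℝ) = ⌈y⌉₊ - 1 := by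
    rw [hn, Nat.cast_sub (by omega)]; simp
  set x := y - n with hx
  have hx0 : 0 < x := by rw [hx, hncast]; linarith
  have hx1 : x ≤ 1 := by rw [hx, hncast]; linarith
  have hyx : y = n + x := by rw [hx]; ring
  -- Bohr–Mollerup lower bound
  have hfeq : ∀ {z : ℝ}, 0 < z → (Real.log ∘ Real.Gamma) (z + 1) =
      (Real.log ∘ Real.Gamma) z + Real.log z := by
    intro z hz
    simp only [Function.comp_apply]
    rw [Real.Gamma_add_one hz.ne', Real.log_mul hz.ne' (Real.Gamma_pos_of_pos hz).ne']
    ring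
  have hBM := Real.BohrMollerup.f_add_nat_ge Real.convexOn_log_Gamma hfeq hn2 hx0
  simp only [Function.comp_apply] at hBM
  -- Stirling for `(n-1)!`
  have hn1 : n - 1 ≠ 0 := by omega
  have hSt := Stirling.le_log_factorial_stirling hn1
  have hGn : Real.Gamma n = (n - 1).factorial := by
    have := Real.Gamma_nat_eq_factorial (n - 1)
    rw [show ((n - 1 : ℕ) : ℝ) + 1 = n by rw [Nat.cast_sub (by omega)]; simp] at this
    exact this
  have hcast1 : ((n - 1 : ℕ) : ℝ) = n - 1 := by rw [Nat.cast_sub (by omega)]; simp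
  rw [hcast1] at hSt
  rw [hGn] at hBM
  -- now estimate
  have hn1pos : (0 : ℝ) < n - 1 := by
    have : (2 : ℝ) ≤ n := by exact_mod_cast hn2
    linarith
  have hnx : 0 < (n : ℝ) + x := by linarith
  have hlog : Real.log ((n + x) / (n - 1)) ≤ (n + x) / (n - 1) - 1 :=
    Real.log_le_sub_one_of_pos (by positivity)
  rw [Real.log_div hnx.ne' hn1pos.ne'] at hlog
  have hcoef : 0 < (n : ℝ) + x - 1 / 2 := by linarith
  rw [hyx]
  have hbound : -(1 + x) * (x + 1 / 2) / (n - 1) ≤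
      Real.log (Real.Gamma (n + x)) - ((n + x - 1 / 2) * Real.log (n + x) - (n + x)
        + Real.log (2 * π) / 2) := by
    have step1 : (n - 1) * Real.log (n - 1) - (n - 1) + Real.log (n - 1) / 2 + Real.log (2 * π) / 2
        + x * Real.log (n - 1) ≤ Real.log (Real.Gamma (n + x)) := by linarith
    have step2 : (n - 1) * Real.log (n - 1) - (n - 1) + Real.log (n - 1) / 2 + Real.log (2 * π) / 2
        + x * Real.log (n - 1) - ((n + x - 1 / 2) * Real.log (n + x) - (n + x) + Real.log (2 * π) / 2)
        = -(n + x - 1 / 2) * (Real.log (n + x) - Real.log (n - 1)) + 1 + x := by ring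
    have step3 : -(n + x - 1 / 2) * (Real.log (n + x) - Real.log (n - 1)) + 1 + x
        ≥ -(n + x - 1 / 2) * ((n + x) / (n - 1) - 1) + 1 + x := by nlinarith
    have step4 : -((n : ℝ) + x - 1 / 2) * ((n + x) / (n - 1) - 1) + 1 + x
        = -(1 + x) * (x + 1 / 2) / (n - 1) := by field_simp; ring
    linarith
  refine le_trans ?_ hbound
  -- `-3/(n+x-2) ≤ -(1+x)(x+1/2)/(n-1)`
  have hnx2 : 0 < (n : ℝ) + x - 2 := by linarith
  rw [div_le_div_iff₀ hnx2 hn1pos]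
  nlinarith [mul_nonneg hx0.le (sub_nonneg.mpr hx1), hx0, hx1, hn1pos]

/-- **Stirling's lower bound for `log Γ` with the first Binet correction.** For every `y > 0`,
`log Γ(y) ≥ (y - ½) log y - y + ½ log(2π) + 1/(12y + 6)`.
(Classically `1/(12y+1)` is admissible; `1/(12y+6)` is what the two-term truncation of Binet's
series and the telescoping `1/t² ≥ 1/t - 1/(t+1)` give.) [folklore] -/
theorem log_gamma_ge_stirling {y : ℝ} (hy : 0 < y) :
    (y - 1 / 2) * Real.log y - y + Real.log (2 * π) / 2 + 1 / (12 * y + 6)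
      ≤ Real.log (Real.Gamma y) := by
  -- for every `K` with `y + K > 2`
  have hK : ∀ K : ℕ, 2 < y + K →
      (1 / 12) * (1 / (y + 1 / 2) - 1 / (y + K + 1 / 2)) + -3 / (y + K - 2)
        ≤ Real.log (Real.Gamma y) - ((y - 1 / 2) * Real.log y - y + Real.log (2 * π) / 2) := by
    intro K hK2
    have h1 := binet_ge_sum y hy K
    have h2 := sum_binet_term_ge y hy K
    have h3 := binet_ge_neg hK2
    linarith
  -- let `K → ∞`
  have hlim : Tendsto (fun K : ℕ => (1 / 12) * (1 / (y + 1 / 2) - 1 / (y + K + 1 / 2))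
      + -3 / (y + K - 2)) atTop (𝓝 ((1 / 12) * (1 / (y + 1 / 2) - 0) + 0)) := by
    have hA : Tendsto (fun K : ℕ => y + K + 1 / 2) atTop atTop := by
      have : Tendsto (fun K : ℕ => (K : ℝ) + (y + 1 / 2)) atTop atTop :=
        tendsto_natCast_atTop_atTop.atTop_add tendsto_const_nhds
      refine this.congr fun K => by ring
    have hB : Tendsto (fun K : ℕ => y + K - 2) atTop atTop := by
      have : Tendsto (fun K : ℕ => (K : ℝ) + (y - 2)) atTop atTop :=
        tendsto_natCast_atTop_atTop.atTop_add tendsto_const_nhds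
      refine this.congr fun K => by ring
    refine Tendsto.add (Tendsto.const_mul _ (tendsto_const_nhds.sub ?_)) ?_
    · exact tendsto_const_nhds.div_atTop hA
    · exact tendsto_const_nhds.div_atTop hB
  have hev : ∀ᶠ K : ℕ in atTop, (1 / 12) * (1 / (y + 1 / 2) - 1 / (y + K + 1 / 2))
      + -3 / (y + K - 2)
        ≤ Real.log (Real.Gamma y) - ((y - 1 / 2) * Real.log y - y + Real.log (2 * π) / 2) := by
    filter_upwards [eventually_gt_atTop ⌈(2 : ℝ) - y⌉₊] with K hK'
    refine hK K ?_
    have : (2 : ℝ) - y ≤ ⌈(2 : ℝ) - y⌉₊ := Nat.le_ceil _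
    have : ((⌈(2 : ℝ) - y⌉₊ : ℕ) : ℝ) < K := by exact_mod_cast hK'
    linarith
  have := le_of_tendsto hlim hev
  simp only [sub_zero, add_zero] at this
  have e : (1 : ℝ) / 12 * (1 / (y + 1 / 2)) = 1 / (12 * y + 6) := by
    field_simp; ring
  rw [e] at this
  linarith

/-- Exponentiated form: `Γ(y) ≥ √(2π) · y^{y-½} · e^{-y} · e^{1/(12y+6)}` for `y > 0`. [folklore] -/
theorem gamma_ge_stirling {y : ℝ} (hy : 0 < y) :
    Real.sqrt (2 * π) * y ^ (y - 1 / 2) * Real.exp (-y) * Real.exp (1 / (12 * y + 6))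
      ≤ Real.Gamma y := by
  have h := log_gamma_ge_stirling hy
  have hG := Real.Gamma_pos_of_pos hy
  rw [← Real.log_le_log_iff (by positivity) hG]
  rw [Real.log_mul (by positivity) (by positivity), Real.log_mul (by positivity) (by positivity),
    Real.log_mul (by positivity) (by positivity), Real.log_exp, Real.log_exp,
    Real.log_rpow hy, Real.log_sqrt (by positivity)]
  linarith

end Literature.Analysis.SpecialFunctions.LogGammaStirling
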